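import Literature.Probability.Percolation.ArmSeparationInnerBound
import Literature.Probability.Percolation.ArmSeparationIntRSWAt
import Literature.Probability.Percolation.ArmSeparationIntFenceBoundAt
import HarnessLib

/-!
# Inner separation at a general density `p`: nothing fails around `∂Λ_m` except with small probability

Topic: Probability / Percolation; family `crit-perc` / near-critical percolation on `𝕋`
(`P_p = triSitePercolation p`, ANY `p : unitInterval`). `ArmSeparationInnerBound.lean` bounds the
failure probability of the good event `InGood m T k₀ K R₀ Kg` of Kesten's separation step at the
INNER boundary (`ArmSeparationInner.lean`; Nolin 2008, §4.4, proof of Thm. 11, internal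
extremities, with Lemma 15 [arXiv 0711.4948: Thm. 10, Lemma 14 (4.16)–(4.20)]) at `p = 1/2`, using
the colour symmetry of `P_{1/2}` for the closed guards and the six colour-exchanged configurations.
Nolin's theorem is uniform in `p` below `L(p)`; at a general `p` the closed objects of `P_p` are the
open objects of `P_{1-p}` (`sitePercolation_real_preimage_compl`), so every hypothesis is asked at
the two densities `q ∈ {p, 1 - p}` (a set invariant under `σ`), at the scales used:

* open frames `c_F ≤ P_q(triFrameAt z k)` for `1 ≤ k < S`, with `8 k_j < S` for the fence scales
  `k_j = k₀ 32^j` (`j < K`) and the guard scales `R₀ 32^i` (`i < Kg`);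
* the RSW bound `c ≤ P_q(LR(L, ⌊m/8⌋))` for all widths `L ≤ 24 ⌊m/8⌋` (the blocking "C" of the
  inner half-annulus, `ArmSeparationIntRSWAt.lean`).

Results: `real_not_inGuard_le_at` (`P_p(¬ InGuard) ≤ (1 - c_F²)^{Kg}`, frames at `1 - p`),
`real_inFail_le_at` (`P_p(InFail) ≤ (1 - c⁵)^{T+1} + T (1 - c_F²)^K`), `real_inBad_le_at`, and
`real_not_inGood_le_at`:

  `P_p(¬ InGood m T k₀ K R₀ Kg) ≤ 12 · ((1 - c⁵)^{T+1} + T (1 - c_F²)^K + 2 (1 - c_F²)^{Kg})`.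

Everything here is proved; no named facts are introduced.

## References

* P. Nolin, *Near-critical percolation in two dimensions*, Electron. J. Probab. 13 (2008), Thm. 11
  and §4.4 [arXiv 0711.4948: Thm. 10 (proof, internal extremities), Lemma 14, (4.16)–(4.20)]. [Nolin2008]
* H. Kesten, *Scaling relations for 2D-percolation*, Comm. Math. Phys. 109 (1987), Lemma 2. [Kesten1987]

Tree: `InGuard`, `InFail`, `InGood` (`ArmSeparationInner.lean`); `inBad`, `not_inGood_subset`
(`ArmSeparationInnerBound.lean`); `real_iInter_compl_trapRSW_le_at` (`ArmSeparationFenceBoundAt.lean`);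
`HalfAnnulus.real_lowestSeq_intDom_ne_none_le_at` (`ArmSeparationIntRSWAt.lean`);
`real_intSeqFail_le_at` (`ArmSeparationIntFenceBoundAt.lean`); `real_preimage_rotConfig`
(`ArmSeparationRotate.lean`); `sitePercolation_real_preimage_compl` (`TriHexLemma.lean`).
-/

noncomputable section

open MeasureTheory Set
open scoped unitInterval

namespace Literature.Probability.Percolation

open LatticeModels HalfAnnulus

/-- **A corner guard fails with probability `≤ (1 - c_F²)^{Kg}` at density `p`**: the guard is a
CLOSED double frame, i.e. an open one of `P_{1-p}`, so the frame hypothesis is asked at `σ p`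
(`real_iInter_compl_trapRSW_le_at`; `R₀ ≥ 1`, guard scales `8 R₀ 32^i < S`). [cite: Nolin2008, §4.4 Lemma 15 (proof) (arXiv 0711.4948: Lemma 14, (4.18)), with Thm. 11 "uniformly in p"] -/
theorem real_not_inGuard_le_at (p : unitInterval) {cF : ℝ} (hcF : 0 < cF) {S : ℕ}
    (hF : ∀ (z : Site 2) (k : ℕ), 1 ≤ k → k < S → cF ≤ (triSitePercolation (σ p)).real (triFrameAt z k))
    {R₀ : ℕ} (hR₀ : 1 ≤ R₀) {Kg : ℕ} (hKgS : ∀ i < Kg, 8 * trapScale R₀ i < S) (C : Site 2) :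
    (triSitePercolation p).real {χ | ¬ InGuard R₀ Kg C χ} ≤ (1 - cF ^ 2) ^ Kg := by
  have hset : {χ : SiteConfig (Site 2) | ¬ InGuard R₀ Kg C χ} =
      compl ⁻¹' ⋂ i ∈ Finset.range Kg, (trapRSW C (trapScale R₀ i))ᶜ := by
    ext χ
    simp only [InGuard, not_exists, not_and, Set.mem_setOf_eq, Set.mem_preimage, Set.mem_iInter,
      Set.mem_compl_iff, Finset.mem_range]
  rw [hset]
  unfold triSitePercolation
  rw [sitePercolation_real_preimage_compl]
  have h := (real_iInter_compl_trapRSW_le_at (σ p) hcF hF C hR₀ Kg hKgS).1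
  unfold triSitePercolation at h
  exact h

/-- **Failure at the inner side has small probability, at density `p`**:
`P_p(InFail m T k₀ K R₀) ≤ (1 - c⁵)^{T+1} + T (1 - c_F²)^K` for `m ≥ 8`, `k₀ ≥ 1`, `2 k_j + 1 ≤ R₀`
and `8 k_j < S` (`j < K`), given open frames of probability `≥ c_F ∈ (0, 1]` at `p` (scales `< S`)
and the RSW bound `c ≤ P_{1-p}(LR(L, ⌊m/8⌋))`, `L ≤ 24 ⌊m/8⌋` (`real_lowestSeq_intDom_ne_none_le_at`,
`real_intSeqFail_le_at`). [cite: Nolin2008, §4.4 Lemma 15 (proof) (arXiv 0711.4948: Lemma 14, (4.17)–(4.20)), with Thm. 11 "uniformly in p"] -/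
theorem real_inFail_le_at (p : unitInterval) {cF c : ℝ} (hcF : 0 < cF) (hcF1 : cF ≤ 1) {S : ℕ}
    (hF : ∀ (z : Site 2) (k : ℕ), 1 ≤ k → k < S → cF ≤ (triSitePercolation p).real (triFrameAt z k))
    {m : ℕ} (hm : 8 ≤ m) (hcw : ∀ L : ℕ, L ≤ 24 * (m / 8) → c ≤ triLRCrossingProb (σ p) L (m / 8))
    (hc : 0 ≤ c) {T k₀ K R₀ : ℕ} (hk₀ : 1 ≤ k₀) (hKR : ∀ j < K, 2 * trapScale k₀ j + 1 ≤ R₀)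
    (hKS : ∀ j < K, 8 * trapScale k₀ j < S) :
    (triSitePercolation p).real {χ | InFail m T k₀ K R₀ χ} ≤ (1 - c ^ 5) ^ (T + 1) + T * (1 - cF ^ 2) ^ K := by
  have h1 := real_lowestSeq_intDom_ne_none_le_at p hm hcw hc T
  have h2 := real_intSeqFail_le_at p hcF hcF1 hF (m := m) (T := T) (by omega) hk₀ hKR hKS
  have hsub : {χ : SiteConfig (Site 2) | InFail m T k₀ K R₀ χ} ⊆
      {ω | (intDom m).lowestSeq ω T ≠ none} ∪ {ω | IntSeqFail m T k₀ K R₀ ω} := fun χ hχ => hχ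
  calc (triSitePercolation p).real {χ | InFail m T k₀ K R₀ χ}
      ≤ (triSitePercolation p).real ({ω | (intDom m).lowestSeq ω T ≠ none} ∪ {ω | IntSeqFail m T k₀ K R₀ ω}) :=
        measureReal_mono hsub
    _ ≤ _ := measureReal_union_le _ _
    _ ≤ _ := add_le_add h1 h2

/-- `P_p(inBad) ≤ (1 - c⁵)^{T+1} + T (1 - c_F²)^K + 2 (1 - c_F²)^{Kg}` at density `p`, with the frame
hypothesis at both `p` (fences) and `1 - p` (guards) and the RSW bound at `1 - p`. [cite: Nolin2008, §4.4 Lemma 15 (proof) (arXiv 0711.4948: Lemma 14, (4.20)), with Thm. 11 "uniformly in p"] -/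
theorem real_inBad_le_at (p : unitInterval) {cF c : ℝ} (hcF : 0 < cF) (hcF1 : cF ≤ 1) {S : ℕ}
    (hF : ∀ q : unitInterval, (q = p ∨ q = σ p) →
      ∀ (z : Site 2) (k : ℕ), 1 ≤ k → k < S → cF ≤ (triSitePercolation q).real (triFrameAt z k))
    {m : ℕ} (hm : 8 ≤ m) (hcw : ∀ L : ℕ, L ≤ 24 * (m / 8) → c ≤ triLRCrossingProb (σ p) L (m / 8))
    (hc : 0 ≤ c) {T k₀ K R₀ Kg : ℕ} (hk₀ : 1 ≤ k₀) (hR₀ : 1 ≤ R₀) (hKR : ∀ j < K, 2 * trapScale k₀ j + 1 ≤ R₀)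
    (hKS : ∀ j < K, 8 * trapScale k₀ j < S) (hKgS : ∀ i < Kg, 8 * trapScale R₀ i < S) :
    (triSitePercolation p).real (inBad m T k₀ K R₀ Kg) ≤
      (1 - c ^ 5) ^ (T + 1) + T * (1 - cF ^ 2) ^ K + 2 * (1 - cF ^ 2) ^ Kg := by
  have h1 := real_inFail_le_at p hcF hcF1 (hF p (Or.inl rfl)) hm hcw hc (T := T) hk₀ hKR hKS
  have h2 := real_not_inGuard_le_at p hcF (hF (σ p) (Or.inr rfl)) hR₀ hKgS ![(m : ℤ), -(m : ℤ)]
  have h3 := real_not_inGuard_le_at p hcF (hF (σ p) (Or.inr rfl)) hR₀ hKgS ![(m : ℤ), 0]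
  have hset : inBad m T k₀ K R₀ Kg = {χ | InFail m T k₀ K R₀ χ} ∪
      ({χ | ¬ InGuard R₀ Kg ![(m : ℤ), -(m : ℤ)] χ} ∪ {χ | ¬ InGuard R₀ Kg ![(m : ℤ), 0] χ}) := by
    ext χ; simp only [inBad, Set.mem_setOf_eq, Set.mem_union]
  rw [hset]
  calc (triSitePercolation p).real ({χ | InFail m T k₀ K R₀ χ} ∪
        ({χ | ¬ InGuard R₀ Kg ![(m : ℤ), -(m : ℤ)] χ} ∪ {χ | ¬ InGuard R₀ Kg ![(m : ℤ), 0] χ}))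
      ≤ (triSitePercolation p).real {χ | InFail m T k₀ K R₀ χ} +
          (triSitePercolation p).real ({χ | ¬ InGuard R₀ Kg ![(m : ℤ), -(m : ℤ)] χ} ∪
            {χ | ¬ InGuard R₀ Kg ![(m : ℤ), 0] χ}) := measureReal_union_le _ _
    _ ≤ (triSitePercolation p).real {χ | InFail m T k₀ K R₀ χ} +
          ((triSitePercolation p).real {χ | ¬ InGuard R₀ Kg ![(m : ℤ), -(m : ℤ)] χ} +
            (triSitePercolation p).real {χ | ¬ InGuard R₀ Kg ![(m : ℤ), 0] χ}) :=
        add_le_add le_rfl (measureReal_union_le _ _)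
    _ ≤ _ := by linarith

/-- **Nothing fails around `∂Λ_m` except with small probability, at density `p`** (Nolin 2008,
proof of Thm. 11 with Lemma 15, internal extremities, "for any `p`, any `P̂` between `P_p` and
`P_{1-p}` and any `N ≤ L(p)`"): for `m ≥ 8`, `k₀, R₀ ≥ 1`, `2 k_j + 1 ≤ R₀`, `8 k_j < S` (`j < K`),
`8 R₀ 32^i < S` (`i < Kg`), given at both densities `q ∈ {p, 1 - p}` open frames of probability
`≥ c_F ∈ (0, 1]` at the scales `< S` and the RSW bound `c ≤ P_q(LR(L, ⌊m/8⌋))` (`L ≤ 24 ⌊m/8⌋`),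
`P_p(¬ InGood m T k₀ K R₀ Kg) ≤ 12 · ((1 - c⁵)^{T+1} + T (1 - c_F²)^K + 2 (1 - c_F²)^{Kg})` — six
rotated configurations at `p` (`real_preimage_rotConfig`) and six colour-exchanged ones, of law
`P_{1-p}`. [cite: Nolin2008, §4.4 Lemma 15 and Thm. 11 (proof) (arXiv 0711.4948: Lemma 14 (4.20), Thm. 10), with Thm. 11 "uniformly in p"] -/
theorem real_not_inGood_le_at (p : unitInterval) {cF c : ℝ} (hcF : 0 < cF) (hcF1 : cF ≤ 1) {S : ℕ}
    (hF : ∀ q : unitInterval, (q = p ∨ q = σ p) →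
      ∀ (z : Site 2) (k : ℕ), 1 ≤ k → k < S → cF ≤ (triSitePercolation q).real (triFrameAt z k))
    {m : ℕ} (hm : 8 ≤ m)
    (hcw : ∀ q : unitInterval, (q = p ∨ q = σ p) → ∀ L : ℕ, L ≤ 24 * (m / 8) → c ≤ triLRCrossingProb q L (m / 8))
    (hc : 0 ≤ c) {T k₀ K R₀ Kg : ℕ} (hk₀ : 1 ≤ k₀) (hR₀ : 1 ≤ R₀) (hKR : ∀ j < K, 2 * trapScale k₀ j + 1 ≤ R₀)
    (hKS : ∀ j < K, 8 * trapScale k₀ j < S) (hKgS : ∀ i < Kg, 8 * trapScale R₀ i < S) :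
    (triSitePercolation p).real {ω | ¬ InGood m T k₀ K R₀ Kg ω} ≤
      12 * ((1 - c ^ 5) ^ (T + 1) + T * (1 - cF ^ 2) ^ K + 2 * (1 - cF ^ 2) ^ Kg) := by
  set B := inBad m T k₀ K R₀ Kg with hB
  set ε := (1 - c ^ 5) ^ (T + 1) + T * (1 - cF ^ 2) ^ K + 2 * (1 - cF ^ 2) ^ Kg with hε
  -- the hypotheses are symmetric under `p ↦ σ p`
  have hF' : ∀ q : unitInterval, (q = σ p ∨ q = σ (σ p)) →
      ∀ (z : Site 2) (k : ℕ), 1 ≤ k → k < S → cF ≤ (triSitePercolation q).real (triFrameAt z k) := by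
    intro q hq
    rw [unitInterval.symm_symm] at hq
    exact hF q hq.symm
  have hbad : (triSitePercolation p).real B ≤ ε :=
    real_inBad_le_at p hcF hcF1 hF hm (hcw (σ p) (Or.inr rfl)) hc hk₀ hR₀ hKR hKS hKgS
  have hbad' : (triSitePercolation (σ p)).real B ≤ ε :=
    real_inBad_le_at (σ p) hcF hcF1 hF' hm (by rw [unitInterval.symm_symm]; exact hcw p (Or.inl rfl))
      hc hk₀ hR₀ hKR hKS hKgS
  have hrot : ∀ i : ℕ, (triSitePercolation p).real (rotConfig i ⁻¹' B) ≤ ε := fun i => by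
    rw [real_preimage_rotConfig]; exact hbad
  have hrotc : ∀ i : ℕ, (triSitePercolation p).real (rotConfig i ⁻¹' (compl ⁻¹' B)) ≤ ε := fun i => by
    rw [real_preimage_rotConfig]
    unfold triSitePercolation
    rw [sitePercolation_real_preimage_compl]
    exact hbad'
  calc (triSitePercolation p).real {ω | ¬ InGood m T k₀ K R₀ Kg ω}
      ≤ (triSitePercolation p).real
          (⋃ i ∈ Finset.range 6, (rotConfig i ⁻¹' B ∪ rotConfig i ⁻¹' (compl ⁻¹' B))) :=
        measureReal_mono (not_inGood_subset m T k₀ K R₀ Kg) (measure_ne_top _ _)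
    _ ≤ ∑ i ∈ Finset.range 6, (triSitePercolation p).real (rotConfig i ⁻¹' B ∪ rotConfig i ⁻¹' (compl ⁻¹' B)) :=
        measureReal_biUnion_finset_le _ _
    _ ≤ ∑ i ∈ Finset.range 6, (ε + ε) := Finset.sum_le_sum fun i _ =>
        (measureReal_union_le _ _).trans (add_le_add (hrot i) (hrotc i))
    _ = 12 * ε := by rw [Finset.sum_const, Finset.card_range, nsmul_eq_mul]; push_cast; ring

end Literature.Probability.Percolation
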